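import Summits.CriticalPhenomena.CardyFormulaZ2.Theorems.CardyMeckeFlipMeckeRigidityTranslationErgodic
import Summits.CriticalPhenomena.CardyFormulaZ2.Theorems.CardyMeckeFlipMeckeRigidityCylinderApprox

/-!
# Equal or mutually singular: the dichotomy for flip-extremal isometry-invariant laws

Route `Summits/CriticalPhenomena/CardyFormulaZ2/Theses/CardyMeckeFlip`, crux `MeckeRigidity`
(item stmt-CriticalPhenomena-14826), line `registered`, stub `stub_crossingUniqueness` (helper; the
reduction of the uniqueness stub to a non-singularity statement).

Let `P`, `P'` be two probability laws on the Schramm–Smirnov space `ℋ_ℂ`, each isometry invariant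
((E2)) and each carrying its own admissible kernel family ((ADM)) for which it is flip-fair at
every cutoff ((F)) and flip-extremal ((EXT)).  Then

  **either `P = P'` or `P ⟂ P'` (mutually singular)**

(`eq_or_mutuallySingular`; registered `∀`-form `eq_or_mutuallySingular_of_isFlipExtremal`).
Proof: if `P ≠ P'` they differ on some finite intersection `t` of crossing events (these form a
`π`-system generating the Borel `σ`-field, Schramm–Smirnov Thm. 1.4 (2)), whose indicator is a
`{0,1}`-cylinder function `F`; by translation ergodicity (`ae_tendsto_birkhoffAverage_quadPattern`)
the spatial frequencies of `F` converge `P`-a.s. to `P(t)` and `P'`-a.s. to `P'(t) ≠ P(t)`, so the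
(`P`-conull) convergence set of the first limit is `P'`-null.

Consequence for the uniqueness stub `stub_crossingUniqueness` (two such laws that are in addition
exactly self-dual and RSW have the same crossing values): it is EQUIVALENT to the non-singularity
`¬ P ⟂ P'` of any two such laws, i.e. to the existence of ONE Borel event seen with positive
probability by both in a compatible way — the natural output of a coupling of the two flip
dynamics with positive overlap (`crossedEvent_eq_of_not_mutuallySingular`).
-/

noncomputable section

open MeasureTheory Set Metric Filter Topology
open scoped ENNReal NNReal
open Literature.Probability.Percolation Literature.Probability.Percolation.QuadCrossing

namespace Summit.CriticalPhenomena.CardyFormulaZ2.Theorems.CardyMeckeFlip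

/-- **Equal or mutually singular.**  Two isometry-invariant probability laws on `ℋ_ℂ`, each with an
admissible kernel family for which it is flip-fair at every cutoff and flip-extremal, are either
equal or mutually singular. [folklore] -/
theorem eq_or_mutuallySingular {P P' : Measure (QuadConfig (univ : Set ℂ))}
    [IsProbabilityMeasure P] [IsProbabilityMeasure P']
    {M M' : ℝ → QuadConfig (univ : Set ℂ) → Measure ℂ}
    (hE2 : ∀ g : ℂ ≃ᵢ ℂ, Measure.map (QuadConfig.isometry g) P = P)
    (hE2' : ∀ g : ℂ ≃ᵢ ℂ, Measure.map (QuadConfig.isometry g) P' = P')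
    (hADM : IsAdmissibleKernel P M) (hADM' : IsAdmissibleKernel P' M')
    (hF : ∀ ε : ℝ, 0 < ε → IsFlipFairKernel P (M ε)) (hF' : ∀ ε : ℝ, 0 < ε → IsFlipFairKernel P' (M' ε))
    (hEXT : IsFlipExtremal P M) (hEXT' : IsFlipExtremal P' M') :
    P = P' ∨ P ⟂ₘ P' := by
  by_cases hall : ∀ t ∈ generatePiSystem (range (QuadConfig.crossedEvent (D := (univ : Set ℂ)))), P t = P' t
  · left
    exact ext_of_generate_finite _
      (borel_eq_generateFrom_generatePiSystem_crossedEvent isOpen_univ univ_nonempty)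
      (isPiSystem_generatePiSystem _) hall (by simp)
  right
  push Not at hall
  obtain ⟨t, ht, hne⟩ := hall
  -- `1_t` is an exact `{0,1}`-cylinder function
  obtain ⟨m, Qf, G, hG01, heq⟩ := exists_quadPattern_eq_indicator_of_generatePiSystem ht
  have hG : ∀ B, 0 ≤ G B ∧ G B ≤ 1 := fun B => by
    rcases hG01 B with h | h <;> simp [h]
  have htm : MeasurableSet t := by
    have : MeasurableSet[MeasurableSpace.generateFrom
        (generatePiSystem (range (QuadConfig.crossedEvent (D := (univ : Set ℂ)))))] t :=
      MeasurableSpace.measurableSet_generateFrom ht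
    rwa [← borel_eq_generateFrom_generatePiSystem_crossedEvent isOpen_univ univ_nonempty] at this
  -- the means of the cylinder function are `P(t)` and `P'(t)`
  have hmean : ∀ (μ : Measure (QuadConfig (univ : Set ℂ))), ∫ S, G {j | Qf j ∈ S} ∂μ = μ.real t := by
    intro μ
    rw [← integral_indicator_one htm]
    exact integral_congr_ae (ae_of_all _ fun S => (heq S).symm)
  -- spatial frequencies along the unit translation
  have h1 : (1 : ℂ) ≠ 0 := one_ne_zero
  have hlim := ae_tendsto_birkhoffAverage_quadPattern hE2 hADM hF hEXT h1 Qf G hG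
  have hlim' := ae_tendsto_birkhoffAverage_quadPattern hE2' hADM' hF' hEXT' h1 Qf G hG
  rw [hmean P] at hlim
  rw [hmean P'] at hlim'
  have hne' : P.real t ≠ P'.real t := fun h =>
    hne ((ENNReal.toReal_eq_toReal_iff' (measure_ne_top P t) (measure_ne_top P' t)).1 h)
  -- the convergence set of the `P`-limit is `P`-conull and `P'`-null
  set A : Set (QuadConfig (univ : Set ℂ)) := {S | Tendsto (fun N => birkhoffAverage ℝ
    (QuadConfig.isometry (IsometryEquiv.addLeft (1 : ℂ))) (fun S => G {j | Qf j ∈ S}) N S) atTop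
      (𝓝 (P.real t))} with hA
  have hPA : P Aᶜ = 0 := by
    rw [measure_eq_zero_iff_ae_notMem]
    filter_upwards [hlim] with S hS hSA
    exact hSA hS
  have hP'A : P' A = 0 := by
    rw [measure_eq_zero_iff_ae_notMem]
    filter_upwards [hlim'] with S hS hSA
    exact hne' (tendsto_nhds_unique hSA hS)
  obtain ⟨B, hAB, hBm, hPB⟩ := exists_measurable_superset_of_null hPA
  obtain ⟨B', hAB', hB'm, hP'B'⟩ := exists_measurable_superset_of_null hP'A
  refine ⟨B, hBm, hPB, measure_mono_null (fun S hS => hAB' ?_) hP'B'⟩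
  by_contra hSA
  exact hS (hAB hSA)

/-- **Non-singular laws agree on every crossing event**: under the same hypotheses, if `P` and
`P'` are not mutually singular they give every quad the same crossing probability (indeed they
are equal). [folklore] -/
theorem measureReal_crossedEvent_eq_of_not_mutuallySingular {P P' : Measure (QuadConfig (univ : Set ℂ))}
    [IsProbabilityMeasure P] [IsProbabilityMeasure P']
    {M M' : ℝ → QuadConfig (univ : Set ℂ) → Measure ℂ}
    (hE2 : ∀ g : ℂ ≃ᵢ ℂ, Measure.map (QuadConfig.isometry g) P = P)
    (hE2' : ∀ g : ℂ ≃ᵢ ℂ, Measure.map (QuadConfig.isometry g) P' = P')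
    (hADM : IsAdmissibleKernel P M) (hADM' : IsAdmissibleKernel P' M')
    (hF : ∀ ε : ℝ, 0 < ε → IsFlipFairKernel P (M ε)) (hF' : ∀ ε : ℝ, 0 < ε → IsFlipFairKernel P' (M' ε))
    (hEXT : IsFlipExtremal P M) (hEXT' : IsFlipExtremal P' M') (hns : ¬ P ⟂ₘ P')
    (Q : Quad (univ : Set ℂ)) :
    P.real (QuadConfig.crossedEvent Q) = P'.real (QuadConfig.crossedEvent Q) := by
  rcases eq_or_mutuallySingular hE2 hE2' hADM hADM' hF hF' hEXT hEXT' with h | h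
  · rw [h]
  · exact (hns h).elim

/-- **Registered form** (sub-goal `eq_or_mutuallySingular_of_isFlipExtremal` of item
stmt-CriticalPhenomena-14826): two isometry-invariant probability laws on `ℋ_ℂ`, each admissible,
flip-fair at every cutoff and flip-extremal for its own kernel family, are equal or mutually
singular. [folklore] -/
theorem eq_or_mutuallySingular_of_isFlipExtremal : ∀ (P P' : Measure (QuadConfig (Set.univ : Set ℂ))) (M M' : ℝ → QuadConfig (Set.univ : Set ℂ) → Measure ℂ), IsProbabilityMeasure P → IsProbabilityMeasure P' → (∀ g : ℂ ≃ᵢ ℂ, Measure.map (QuadConfig.isometry g) P = P) → (∀ g : ℂ ≃ᵢ ℂ, Measure.map (QuadConfig.isometry g) P' = P') → IsAdmissibleKernel P M → IsAdmissibleKernel P' M' → (∀ ε : ℝ, 0 < ε → IsFlipFairKernel P (M ε)) → (∀ ε : ℝ, 0 < ε → IsFlipFairKernel P' (M' ε)) → IsFlipExtremal P M → IsFlipExtremal P' M' → P = P' ∨ P ⟂ₘ P' := by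
  intro P P' M M' hP hP' hE2 hE2' hADM hADM' hF hF' hEXT hEXT'
  exact eq_or_mutuallySingular hE2 hE2' hADM hADM' hF hF' hEXT hEXT'

end Summit.CriticalPhenomena.CardyFormulaZ2.Theorems.CardyMeckeFlip

end
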